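import Summits.ABC.ABC.Theses.DefiniteXi
import Literature.NumberTheory.EllipticCurves.DegreeConjectureAbcMurtyProofs
import HarnessLib

/-!
# Route DefiniteXi — support item `PolyDegreeToPolyABC` (stmt-ABC-2027)

**A polynomial degree bound on the Frey curves gives a polynomial abc inequality.** The route
decl `Summit.ABC.ABC.Theses.DefiniteXi.PolyDegreeToPolyABC` reads

> `PolyFreyDegree → ∃ κ C : ℝ, ∀ a b c : ℕ, IsABCTriple a b c → c ≤ C · rad(abc)^κ`,

where `PolyFreyDegree` is the weak rung of the route: absolute `A, C` such that every Frey curve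
`E_{a,b} : y² = x(x − a)(x + b)` (`a, b` coprime, `ab(a+b) ≠ 0`) carries at level `N = N_E` a
modular parametrisation datum of degree `≤ C · N^A`.

This is Frey's argument (Frey 1989; Frey 1997 §3, Cor. 3.1, "version with a general exponent")
in the form of Murty 1999, §2, with the exponents carried explicitly, and it is proved here
UNCONDITIONALLY: every ingredient is a theorem of the tree.

* Zagier's identity `4π² c² (f,f) = deg · covol(Λ)` and the degree bound, rewritten as
  `deg ≤ max(C,0) · c² · N^{2+δ}` with `δ := max(A − 2, 1)` (`N ≥ 1`, `c² ≥ 1`), together with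
  the PROVED Petersson lower bound `(f,f) ≥ c₂ N^{1/4}` (the range `η > 1/2` of Hoffstein–Lockhart,
  `HoffsteinLockhart1994_peterssonProduct_lower_bound_of_half_lt` at `η = 3/4`; a polynomial
  conclusion needs no `GL(3)` input) give `covol(Λ) ≥ κ N^{−(1+δ+3/4)}`
  (`estimates_of_frey_datum`).
* Silverman's covolume inequality (PROVED, `silverman1986_discriminant_c4_covolume_holds`) on the
  global minimal equation (12.17)/(12.18) of the Frey curve (Serre's normalisation
  `exists_arrangement`, `u ∈ {1, 2}`) bounds `|c₄(W₀)|³ ≤ A₀ covol^{−(6+δ)}`, while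
  `c² ≤ 2|c₄(W₀)|` and `N ≤ 2¹⁰ rad(abc)`; `pow_six_le_of_estimates_exp` assembles
  `c⁶ ≤ M · rad(abc)^{(1+δ+3/4)(6+δ)}`.

Hence `κ = (1 + δ + 3/4)(6 + δ)/6`. The proof is the proof of
`Literature.NumberTheory.EllipticCurves.abcLe_rpow_of_freyDegreeConjecture_of_petersson` with the
degree exponent frozen.

## References

* G. Frey, *On ternary equations of Fermat type and relations with elliptic curves*, in: Modular
  Forms and Fermat's Last Theorem (1997), §3, Cor. 3.1. [Frey1997Ternary]
* M. R. Murty, *Bounds for congruence primes*, Proc. Sympos. Pure Math. 66.1 (1999), Thm. 1, §2.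
  [MurtyCongruencePrimes1999]
* H. Pasten, *Shimura curves and the abc conjecture*, arXiv:1705.09251 = JNT 254 (2024), §3.
  [PastenShimura2024]
* J. H. Silverman, *Heights and elliptic curves*, in: Arithmetic Geometry (1986), Cor. 2.3.
  [Silverman1986]
-/

-- `Summit.<Summit>.<Problem>` is the mandated summit-side namespace (CONVENTIONS §2); for the
-- single-conjunct summit `ABC` the two coincide, so the duplicate `ABC.ABC` is deliberate.
set_option linter.dupNamespace false

noncomputable section

namespace Summit.ABC.ABC.Theorems

open IsDedekindDomain WeierstrassCurve UniqueFactorizationMonoid CongruenceSubgroup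
open Literature.NumberTheory
open Literature.NumberTheory.EllipticCurves
open Literature.NumberTheory.EllipticCurves.ModularForms

/-- Sixth roots with a free exponent: `c⁶ ≤ M R^e` with `c, M ≥ 0`, `R ≥ 1` gives
`c ≤ M^{1/6} R^{e/6}`. [folklore] -/
theorem PolyDegreeToPolyABC.le_of_pow_six_le_exp {c M R e : ℝ} (hc : 0 ≤ c) (hM : 0 ≤ M)
    (hR : 1 ≤ R) (h : c ^ 6 ≤ M * R ^ e) : c ≤ M ^ (1 / 6 : ℝ) * R ^ (e / 6) := by
  have h' := le_of_pow_six_le (ε := e / 6 - 1) hc hM hR (by linarith) h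
  rwa [show 1 + (e / 6 - 1) = e / 6 by ring] at h'

/-- **Frey 1997, Cor. 3.1 / Murty 1999, §2 with a frozen degree exponent.** If for some `δ > 0`
and `C₀` every Frey curve `E_{a,b}` (`a, b` coprime, `ab(a+b) ≠ 0`) carries at the level of its
conductor a modular parametrisation datum of degree `≤ C₀ N^{2+δ}`, then every abc triple
satisfies `c ≤ C · rad(abc)^{(1+δ+3/4)(6+δ)/6}`. Unconditional: Zagier's identity, the proved
Petersson bound `(f,f) ≫ N^{1/4}` (`HoffsteinLockhart1994_peterssonProduct_lower_bound_of_half_lt`),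
Silverman's proved covolume inequality, the global minimal equations (12.17)/(12.18).
[cite: Frey1997Ternary, §3 Cor. 3.1] -/
theorem PolyDegreeToPolyABC.abcLe_rpow_of_freyDegreeBound_exp {δ C₀ : ℝ} (hδ : 0 < δ)
    (hC₀ : ∀ a b : ℤ, IsCoprime a b → a * b * (a + b) ≠ 0 →
      ∀ (N : ℕ) [NeZero N], (freyCurve a b).conductorNorm ℤ = N →
        ∃ D : ModularParametrizationData (freyCurve a b) N,
          (D.deg : ℝ) ≤ C₀ * (N : ℝ) ^ (2 + δ)) :
    ∃ C : ℝ, ∀ a b c : ℕ, DiophantineGeometry.IsABCTriple a b c →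
      (c : ℝ) ≤ C * ((DiophantineGeometry.rad a b c : ℕ) : ℝ) ^ ((1 + δ + 3 / 4) * (6 + δ) / 6) := by
  -- constants, depending on `δ, C₀` only
  have hη : (1 : ℝ) / 2 < 3 / 4 := by norm_num
  obtain ⟨c₂, hc₂, hPc⟩ := HoffsteinLockhart1994_peterssonProduct_lower_bound_of_half_lt hη
  obtain ⟨A₀, hA₀⟩ := silverman1986_discriminant_c4_covolume_holds δ hδ
  have hA : (0 : ℝ) ≤ max A₀ 1 := zero_le_one.trans (le_max_right _ _)
  have hC₁ : (0 : ℝ) < max C₀ 1 := one_pos.trans_le (le_max_right _ _)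
  set e : ℝ := 1 + δ + 3 / 4 with hedef
  have he : 0 ≤ e := by positivity
  set κ : ℝ := 4 * Real.pi ^ 2 * c₂ / max C₀ 1 with hκdef
  have hκ : 0 < κ := div_pos (by positivity) hC₁
  set M : ℝ := 8 * max A₀ 1 * κ ^ (-(6 + δ)) * (2 ^ 10) ^ (e * (6 + δ)) with hMdef
  have hM : 0 ≤ M := by positivity
  refine ⟨M ^ (1 / 6 : ℝ), fun a b c h ↦ ?_⟩
  have h' := h
  obtain ⟨ha, hb, habc, hcop⟩ := h'
  have hc0 : 0 < c := by omega
  have habc0 : a * b * c ≠ 0 := by positivity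
  set R : ℝ := ((DiophantineGeometry.rad a b c : ℕ) : ℝ) with hRdef
  have hRpos : 0 < DiophantineGeometry.rad a b c := by
    rw [DiophantineGeometry.rad_def]; exact Nat.pos_of_ne_zero radical_ne_zero
  have hR : (1 : ℝ) ≤ R := by rw [hRdef]; exact_mod_cast hRpos
  -- the degree bound in `c²`-form at a datum handed out by `hC₀`
  have hform : ∀ {A B : ℤ} {N : ℕ} [NeZero N] (D : ModularParametrizationData (freyCurve A B) N),
      (D.deg : ℝ) ≤ C₀ * (N : ℝ) ^ (2 + δ) →
        (D.deg : ℝ) ≤ max C₀ 1 * (D.c : ℝ) ^ 2 * (N : ℝ) ^ (2 + δ) := by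
    intro A B N _ D hD
    have hc1 : (1 : ℝ) ≤ (D.c : ℝ) ^ 2 := by
      have h1 : (1 : ℤ) ≤ D.c ^ 2 := by
        have h0' : D.c ≠ 0 := D.maninConstant_ne_zero_holds
        nlinarith [Int.one_le_abs h0', sq_abs D.c]
      exact_mod_cast h1
    have hN0 : (0 : ℝ) ≤ (N : ℝ) ^ (2 + δ) := by positivity
    calc (D.deg : ℝ) ≤ C₀ * (N : ℝ) ^ (2 + δ) := hD
      _ ≤ max C₀ 1 * (N : ℝ) ^ (2 + δ) := mul_le_mul_of_nonneg_right (le_max_left _ _) hN0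
      _ = max C₀ 1 * 1 * (N : ℝ) ^ (2 + δ) := by ring
      _ ≤ max C₀ 1 * (D.c : ℝ) ^ 2 * (N : ℝ) ^ (2 + δ) :=
          mul_le_mul_of_nonneg_right (mul_le_mul_of_nonneg_left hc1 hC₁.le) hN0
  -- the estimates: `∃ cov cov' N c4, …`
  obtain ⟨cov, cov', Nr, c4, hcovpos, hcc4, hc₄, hcc, hlow, hNpos, hNR⟩ :
      ∃ cov cov' Nr c4 : ℝ, 0 < cov ∧ (c : ℝ) ^ 2 ≤ 2 * c4 ∧
        c4 ^ 3 ≤ max A₀ 1 * cov' ^ (-(6 + δ)) ∧ cov ≤ cov' ∧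
        κ * Nr ^ (-e) ≤ cov ∧ 0 < Nr ∧ Nr ≤ 2 ^ 10 * R := by
    by_cases h16 : 16 ∣ a * b * c
    · -- Serre's normalisation and the model (12.18), `u = 2`
      obtain ⟨A, B, hAB, hA4, hB, hprod, hquad⟩ := exists_arrangement h h16
      have h0 : A * B * (A + B) ≠ 0 := by
        rw [← Int.natAbs_ne_zero, hprod]; exact habc0
      have h4 : 4 ∣ B - A - 1 := by
        have : B - A - 1 = B - (A + 1) := by ring
        rw [this]; exact dvd_sub (dvd_trans (by norm_num) hB) hA4
      have h16' : 16 ∣ A * B := dvd_mul_of_dvd_right hB _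
      haveI := isElliptic_freyCurve h0
      set Cv : VariableChange ℚ := ⟨Units.mk0 (2 : ℚ) two_ne_zero, 0, 1, 0⟩ with hCv
      have hCW : Cv • freyCurve A B = (freyIntModel₂ A B).baseChange ℚ :=
        smul_freyCurve_eq_baseChange_freyIntModel₂ h4 h16'
      have hu : 1 ≤ ‖((Cv.u : ℚ) : ℂ)‖ := by simp [hCv]
      set N : ℕ := (freyCurve A B).conductorNorm ℤ with hNdef
      have hN0 : 0 < N := conductorNorm_pos_holds (freyCurve A B)
      haveI : NeZero N := ⟨hN0.ne'⟩
      obtain ⟨D, hD⟩ := hC₀ A B hAB h0 N hNdef.symm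
      obtain ⟨cov, cov', hcov, hc₄, hcc, hlow⟩ := estimates_of_frey_datum (freyIntModel₂ A B)
        (isMinimalAt_freyIntModel₂ hAB hA4 hB) (isElliptic_freyIntModel₂ h0 h4 h16') Cv hCW hu
        D hC₁ (hform D hD) (hPc N (freyCurve A B) D) hA₀
      -- the conductor: `N_E = cond (12.18) ∣ rad (AB(A+B)) = rad (abc)`
      have hcond : (freyCurve A B).conductorNorm ℤ =
          ((freyIntModel₂ A B).baseChange ℚ).conductorNorm ℤ := by
        have hinv := conductor_smul ℤ (freyCurve A B) (fun v ↦ ordMinimalDiscriminant_smul_holds v _)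
          (fun v ↦ kodairaSymbol_smul_holds _) Cv
        unfold conductorNorm
        rw [← hinv, hCW]
      have hdvd : N ∣ DiophantineGeometry.rad a b c := by
        rw [hNdef, hcond, DiophantineGeometry.rad_def, ← hprod]
        exact conductorNorm_freyIntModel₂_dvd hAB h0 hA4 hB
      have hNle : ((N : ℕ) : ℝ) ≤ 2 ^ 10 * R := by
        have h1 : ((N : ℕ) : ℝ) ≤ R := by
          rw [hRdef]; exact_mod_cast Nat.le_of_dvd hRpos hdvd
        exact h1.trans (le_mul_of_one_le_left (zero_le_one.trans hR) (by norm_num))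
      have hNpos : (0 : ℝ) < ((N : ℕ) : ℝ) := by exact_mod_cast hN0
      -- `c² ≤ 2 c₄'`, `c₄' = A² + AB + B² = (a² + b² + c²)/2`
      have hcc4 : (c : ℝ) ^ 2 ≤ 2 * |((freyIntModel₂ A B).c₄ : ℝ)| := by
        rw [freyIntModel₂_c₄ h4 h16']
        have hq : (0 : ℤ) ≤ A ^ 2 + A * B + B ^ 2 := by
          nlinarith [sq_nonneg (A + B), sq_nonneg A, sq_nonneg B]
        have hz : ((c : ℕ) : ℤ) ^ 2 ≤ 2 * |A ^ 2 + A * B + B ^ 2| := by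
          rw [abs_of_nonneg hq, hquad]; nlinarith [sq_nonneg (a : ℤ), sq_nonneg (b : ℤ)]
        have hzr : (((c : ℕ) : ℤ) : ℝ) ^ 2 ≤ 2 * |((A ^ 2 + A * B + B ^ 2 : ℤ) : ℝ)| := by
          exact_mod_cast hz
        simpa using hzr
      exact ⟨cov, cov', _, _, hcov, hcc4, hc₄, hcc, hlow, hNpos, hNle⟩
    · -- (12.17) is already minimal, `u = 1`
      have hab : IsCoprime (a : ℤ) (b : ℤ) := Nat.isCoprime_iff_coprime.mpr hcop
      have hPz : (a : ℤ) * b * (a + b) = ((a * b * c : ℕ) : ℤ) := by rw [← habc]; push_cast; ring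
      have h0 : (a : ℤ) * b * (a + b) ≠ 0 := by rw [hPz]; exact_mod_cast habc0
      have h16' : ¬ (16 : ℤ) ∣ (a : ℤ) * b * (a + b) := by
        rw [hPz]; exact_mod_cast mt Int.natCast_dvd_natCast.mp h16
      haveI := isElliptic_freyCurve h0
      have hCW : (1 : VariableChange ℚ) • freyCurve (a : ℤ) (b : ℤ) =
          (freyIntModel (a : ℤ) (b : ℤ)).baseChange ℚ := by
        rw [one_smul, baseChange_freyIntModel]
      have hu : 1 ≤ ‖(((1 : VariableChange ℚ).u : ℚ) : ℂ)‖ := by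
        simp [WeierstrassCurve.VariableChange.one_def]
      set N : ℕ := (freyCurve (a : ℤ) (b : ℤ)).conductorNorm ℤ with hNdef
      have hN0 : 0 < N := conductorNorm_pos_holds (freyCurve (a : ℤ) (b : ℤ))
      haveI : NeZero N := ⟨hN0.ne'⟩
      obtain ⟨D, hD⟩ := hC₀ (a : ℤ) (b : ℤ) hab h0 N hNdef.symm
      obtain ⟨cov, cov', hcov, hc₄, hcc, hlow⟩ := estimates_of_frey_datum
        (freyIntModel (a : ℤ) (b : ℤ)) (isMinimalAt_freyIntModel hab h0 h16')
        (isElliptic_freyIntModel h0) 1 hCW hu D hC₁ (hform D hD)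
        (hPc N (freyCurve (a : ℤ) (b : ℤ)) D) hA₀
      have hdvd : N ∣ 2 ^ 10 * DiophantineGeometry.rad a b c := by
        have := conductorNorm_freyIntModel_dvd hab h0 h16'
        rwa [baseChange_freyIntModel, hPz, Int.natAbs_natCast, ← DiophantineGeometry.rad_def] at this
      have hNle : ((N : ℕ) : ℝ) ≤ 2 ^ 10 * R := by
        rw [hRdef]; exact_mod_cast Nat.le_of_dvd (by positivity) hdvd
      have hNpos : (0 : ℝ) < ((N : ℕ) : ℝ) := by exact_mod_cast hN0
      have hcc4 : (c : ℝ) ^ 2 ≤ 2 * |((freyIntModel (a : ℤ) (b : ℤ)).c₄ : ℝ)| := by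
        rw [freyIntModel_c₄]
        have hq : (0 : ℝ) ≤ (a : ℝ) ^ 2 + a * b + b ^ 2 := by positivity
        have hc' : (c : ℝ) = a + b := by rw [← habc]; push_cast; ring
        push_cast
        rw [abs_of_nonneg (by positivity), hc']
        nlinarith [hq, sq_nonneg ((a : ℝ) - b)]
      exact ⟨cov, cov', _, _, hcov, hcc4, hc₄, hcc, hlow, hNpos, hNle⟩
  -- bookkeeping
  have h6 := pow_six_le_of_estimates_exp hδ he hA hκ hNpos hcovpos hcc4 hc₄ hcc hlow hNR hR
  exact PolyDegreeToPolyABC.le_of_pow_six_le_exp (Nat.cast_nonneg c) hM hR h6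

/-- **Item `PolyDegreeToPolyABC` (stmt-ABC-2027) of route `ABC/DefiniteXi`, proved
unconditionally**: a polynomial degree bound `deg ≤ C N^A` for some modular parametrisation datum
of every Frey curve (`PolyFreyDegree`) yields a polynomial abc inequality `c ≤ C' rad(abc)^κ`,
with `κ = (1 + δ + 3/4)(6 + δ)/6`, `δ = max(A − 2, 1)` (so that `C N^A ≤ max(C,0) N^{2+δ}` as
`N ≥ 1`). Frey 1997, Cor. 3.1 (general exponent) in the form of Murty 1999 §2; every analytic
ingredient is a theorem of the tree (`abcLe_rpow_of_freyDegreeBound_exp`).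
[cite: Frey1997Ternary, §3 Cor. 3.1] -/
theorem polyDegreeToPolyABC_proof : Summit.ABC.ABC.Theses.DefiniteXi.PolyDegreeToPolyABC := by
  unfold Summit.ABC.ABC.Theses.DefiniteXi.PolyDegreeToPolyABC
  rintro ⟨A, C, hAC⟩
  set δ : ℝ := max (A - 2) 1 with hδdef
  have hδ : 0 < δ := one_pos.trans_le (le_max_right _ _)
  have hAδ : A ≤ 2 + δ := by have := le_max_left (A - 2) 1; linarith
  -- `deg ≤ C N^A ≤ max(C,0) N^{2+δ}`
  have hC₀ : ∀ a b : ℤ, IsCoprime a b → a * b * (a + b) ≠ 0 →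
      ∀ (N : ℕ) [NeZero N], (freyCurve a b).conductorNorm ℤ = N →
        ∃ D : ModularParametrizationData (freyCurve a b) N,
          (D.deg : ℝ) ≤ max C 0 * (N : ℝ) ^ (2 + δ) := by
    intro a b hab h0 N _ hN
    obtain ⟨D, hD⟩ := hAC a b hab h0 N hN
    have hN1 : (1 : ℝ) ≤ (N : ℝ) := by exact_mod_cast Nat.pos_of_ne_zero (NeZero.ne N)
    refine ⟨D, hD.trans ?_⟩
    calc C * (N : ℝ) ^ A ≤ max C 0 * (N : ℝ) ^ A :=
          mul_le_mul_of_nonneg_right (le_max_left _ _) (by positivity)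
      _ ≤ max C 0 * (N : ℝ) ^ (2 + δ) :=
          mul_le_mul_of_nonneg_left (Real.rpow_le_rpow_of_exponent_le hN1 hAδ) (le_max_right _ _)
  obtain ⟨C', hC'⟩ := PolyDegreeToPolyABC.abcLe_rpow_of_freyDegreeBound_exp hδ hC₀
  exact ⟨(1 + δ + 3 / 4) * (6 + δ) / 6, C', hC'⟩

end Summit.ABC.ABC.Theorems

end
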